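import Literature.AnabelianGeometry.AbsoluteAnabelian.AbsTopIThm26vFullSigmaProofs
import Literature.AnabelianGeometry.AbsoluteAnabelian.AbsTopIThm26iiiClauseOneAlmostPro
import HarnessLib

/-!
# [AbsTopI] Thm 2.6 (v), general form, regime `Σ ≠ 𝔓𝔯𝔦𝔪𝔢𝔰`, for the Def 2.1 (i) datum «`Δ` ALMOST pro-`Σ`»

S. Mochizuki, *Topics in Absolute Anabelian Geometry I: Generalities* (2012) [AbsTopI] (lit key
`paper:url-11ac98ba15fc`), Def 1.1 (iii) p. 10, Def 2.1 (i) p. 17, Thm 2.6 (iii)/(v) p. 22, proof p. 23–24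
("If `Σ ≠ 𝔓𝔯𝔦𝔪𝔢𝔰`, then it follows from the definition of `Θ`, together with assertion (iv), that `Θ = Δ`").

PROOF-ONLY sequel (abc-iut-w6-d071, L4 row «THM26-ALMOST-PROSIGMA», file 4).  abc-iut-w6-d034's
`AbsTopIThm26vFullSigmaProofs.lean` closes the typed `E.Thm26vFull B` in the regime "some prime `q ∉ Σ`" FROM THE
CONSTRUCTION DATA ALONE (`MLFBase.thm26vFull_of_exists_prime_not_mem`: MLF base data, `Δ` tfg, `Π` tfg, `Δ`
PRO-`Σ`), using (iii) clause 1 at every open `H` (w6-d073's `deltaInv_two_eq_zero_of_isProSet`).  Print's Def 2.1 (i)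
makes `Δ` only ALMOST pro-`Σ`; with clause 1 now proved for that datum (`deltaInv_two_eq_zero_of_isAlmostPro`,
`AbsTopIThm26iiiClauseOneAlmostPro.lean`, corestriction route) the whole regime closer re-keys:

* `zetaTildeInv_eq_of_inputs'_of_isAlmostPro` — the weakened-inputs core over `IsAlmostPro (Ker a) S`;
* `MLFBase.exists_openSubgroup_inputs_of_isAlmostPro` — the inputs at an open `H ⊆ Π` (`Δ ∩ H` almost pro-`Σ`);
* `MLFBase.thetaSet_two_subset_of_isOpen_of_isAlmostPro` — (iii) clause 1 at every open `H ⊆ Π`;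
* `MLFBase.thm26vFull_of_isAlmostPro_of_tfg`, **`MLFBase.thm26vFull_of_exists_prime_not_mem_of_isAlmostPro`** — Thm
  2.6 (v), general `Θ`, in the regime `Σ ≠ 𝔓𝔯𝔦𝔪𝔢𝔰`, kernel-checked from: MLF base data, `Δ` tfg (Prop 2.2), `Π` tfg
  (Thm 2.6 (ii) clause 1), `Δ` ALMOST pro-`Σ` (Def 2.1 (i)) — nothing else.

Everything is the landed text with the three mechanisms (M1)–(M3) of `AbsTopIAlmostProSigmaBridge.lean` substituted;
nothing of the landed files is edited.  HONEST SCOPE: refereed, undisputed statement; the regime `Σ = 𝔓𝔯𝔦𝔪𝔢𝔰` keeps its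
named inputs (rank identity, (iii) clause 2) exactly as before; nothing here bears on [IUTchIII] Cor. 3.12.
-/

noncomputable section

open Topology

namespace Literature.AnabelianGeometry.AbsoluteAnabelian

universe u v

section Core

variable {Λ : Type u} [Group Λ] [TopologicalSpace Λ] [IsTopologicalGroup Λ]
variable {Γ : Type v} [Group Γ] [TopologicalSpace Γ] [IsTopologicalGroup Γ] [T2Space Γ]

omit [IsTopologicalGroup Γ] in
/-- For a continuous surjection `a : G ↠ Γ` from a compact group onto a Hausdorff group, the
quotient of `G` by a normal subgroup EQUAL to `Ker a` is bicontinuously isomorphic to `Γ`.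
[folklore] -/
private theorem nonempty_continuousMulEquiv_quotient_of_eq_ker₃ [CompactSpace Λ] (a : Λ →ₜ* Γ)
    (ha : Function.Surjective a) (N : Subgroup Λ) [N.Normal] (hN : N = a.toMonoidHom.ker) :
    Nonempty (Λ ⧸ N ≃ₜ* Γ) := by
  subst hN
  let e₀ : Λ ⧸ a.toMonoidHom.ker ≃* Γ := QuotientGroup.quotientKerEquivOfSurjective a.toMonoidHom ha
  have hc : Continuous e₀ := by
    rw [← QuotientGroup.isOpenQuotientMap_mk.continuous_comp_iff]
    have : (e₀ : Λ ⧸ a.toMonoidHom.ker → Γ) ∘ QuotientGroup.mk = a := funext fun _ => rfl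
    rw [this]
    exact a.continuous
  let h : Λ ⧸ a.toMonoidHom.ker ≃ₜ Γ := hc.homeoOfEquivCompactToT2 (f := e₀.toEquiv)
  exact ⟨{ e₀ with
    continuous_toFun := h.continuous
    continuous_invFun := h.symm.continuous }⟩

/-- **The core of [AbsTopI] Thm 2.6 (v) with weakened inputs, over a `Ker a` that is only ALMOST pro-`Σ`** (twin of abc-iut-w6-d034's `zetaTildeInv_eq_of_inputs'`).  Same setting as
`zetaTildeInv_eq_of_inputs` (`a : Λ ↠ Γ`, `Γ` "`G_k`-like", `Ker a` tfg and pro-`Σ`), but the rank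
identity of (ii) and the SECOND clause of (iii) are required only when every prime lies in `Σ`; the
first clause of (iii) (`θ²(Λ) ⊆ Σ`) is required always.  For `Σ ∌ q` the printed proof (p. 24
l. 10–16) uses (iv) alone: `Δ` is the unique maximal almost pro-omissive tfg closed normal subgroup,
`θ²(Λ) ⊆ Σ ≠ Primes`, so `Θ = Δ` and `Λ/Θ ≅ Γ`. [cite: MochizukiAbsTopI2012, Thm 2.6 (v) proof p.24] -/
theorem zetaTildeInv_eq_of_inputs'_of_isAlmostPro [CompactSpace Λ] [T2Space Λ] (a : Λ →ₜ* Γ)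
    (ha : Function.Surjective a)
    (hΓ : ∀ M : Subgroup Γ, M.Normal → IsClosed (M : Set Γ) → IsTopologicallyFinitelyGenerated M →
      IsAlmostProOmissive M → M = ⊥)
    (p : ℕ) [hp : Fact p.Prime] (D : ℕ) (hΓp : freeProlRank Γ p = ((1 + D : ℕ) : ℕ∞))
    (hΓl : ∀ (l : ℕ) [Fact l.Prime], l ≠ p → freeProlRank Γ l = 1)
    {S : Set ℕ} (hS : S ⊆ {q | q.Prime})
    (hΔfg : IsTopologicallyFinitelyGenerated a.toMonoidHom.ker)
    (hΔS : IsAlmostPro a.toMonoidHom.ker S)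
    (hiii₁ : thetaSet Λ 2 ⊆ {l ∈ S | l.Prime})
    (hQ : (∀ q : ℕ, q.Prime → q ∈ S) →
      ∃ m : ℕ, ∀ (l : ℕ) [Fact l.Prime], freeProlRank Λ l = freeProlRank Γ l + m)
    (hiii₂ : (∀ q : ℕ, q.Prime → q ∈ S) →
      2 ≤ (thetaSet Λ 1).encard → thetaSet Λ 2 = {l | l.Prime}) :
    zetaTildeInv Λ = (D : ℕ∞) := by
  by_cases hall : ∀ q : ℕ, q.Prime → q ∈ S
  · -- every prime in `Σ`: the original core applies
    have hSP : {l ∈ S | l.Prime} = {l | l.Prime} := by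
      ext l
      simp only [Set.mem_setOf_eq, and_iff_right_iff_imp]
      exact hall l
    obtain ⟨m, hm⟩ := hQ hall
    refine zetaTildeInv_eq_of_inputs a ha hΓ p D hΓp hΓl hS hΔfg ⟨fun _ _ _ q hq _ => hall q hq⟩
      ⟨m, fun l _ _ => hm l⟩ ⟨hiii₁, fun h2 => ?_⟩
    rw [hiii₂ hall h2, hSP]
  · -- some prime `q ∉ Σ`: `Θ = Δ`, `Λ/Θ ≅ Γ`
    push Not at hall
    obtain ⟨q, hq, hqS⟩ := hall
    set Δ : Subgroup Λ := a.toMonoidHom.ker with hΔdef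
    have hΔc : IsClosed (Δ : Set Λ) := by
      rw [hΔdef, MonoidHom.coe_ker]
      exact isClosed_singleton.preimage a.continuous
    have step1 : ∀ N : Subgroup Λ, N.Normal → IsClosed (N : Set Λ) →
        IsTopologicallyFinitelyGenerated N → IsAlmostProOmissive N → N ≤ Δ :=
      fun N hN hNc hNfg hNapo => le_ker_of_isAlmostProOmissive a ha hΓ N hN hNc hNfg hNapo
    have hΓl' : ∀ (l : ℕ) [Fact l.Prime], l ≠ p → freeProlRank Γ l = ((1 : ℕ) : ℕ∞) := by
      intro l _ hl; rw [hΓl l hl, Nat.cast_one]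
    have ζΓ : zetaInv Γ = (D : ℕ∞) := zetaInv_eq_of_freeProlRank_eq p 1 D hΓp hΓl'
    have hΔapo : IsAlmostProOmissive Δ := hΔS.isAlmostProOmissive_of_prime_not_mem hS hq hqS
    have hΔmax : IsMaximalAPONormal Λ Δ :=
      ⟨⟨inferInstance, hΔc, hΔfg, hΔapo⟩,
        fun N' hn hc hfg hapo hle => le_antisymm (step1 N' hn hc hfg hapo) hle⟩
    have huniq : ∃! N : Subgroup Λ, IsMaximalAPONormal Λ N := by
      refine ⟨Δ, hΔmax, fun N hN => ?_⟩
      obtain ⟨⟨hn, hc, hfg, hapo⟩, hmax⟩ := hN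
      exact (hmax Δ inferInstance hΔc hΔfg hΔapo (step1 N hn hc hfg hapo)).symm
    have h2 : thetaSet Λ 2 ≠ {l | l.Prime} := by
      intro h
      have hq2 : q ∈ thetaSet Λ 2 := by rw [h]; exact hq
      exact hqS (hiii₁ hq2).1
    have hΘ : thetaSubgroup Λ = Δ := thetaSubgroup_eq_of_isMaximalAPONormal Λ h2 huniq hΔmax
    have hM : (thetaSubgroup Λ).normalCore = a.toMonoidHom.ker := by
      rw [normalCore_thetaSubgroup, hΘ]
    obtain ⟨e⟩ := nonempty_continuousMulEquiv_quotient_of_eq_ker₃ a ha _ hM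
    unfold zetaTildeInv
    rw [zetaInv_congr_of_freeProlRank_eq (fun q _ => freeProlRank_eq_of_continuousMulEquiv e q), ζΓ]

end Core

namespace FundamentalExtension

variable {E : FundamentalExtension.{0}}

/-- **The inputs of the core at an open subgroup `H ⊆ Π`, `Δ` ALMOST pro-`Σ`** (twin of `MLFBase.exists_openSubgroup_inputs`): the restricted
augmentation `H ↠ G_H := aug(H)` is a continuous surjection onto a "`G_k`-like" group (elasticity of
`G_k` inside the open `G_H`, `MLFBase.eq_bot_of_isAlmostProOmissive_of_isOpen`), its kernel
`Δ ∩ H` is topologically finitely generated (open in the tfg compact `Δ`) and pro-`Σ`, and the ranks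
of `G_H ≅ G_{k_H}` are `δ¹_l = 1` (`l ≠ p`), `δ¹_p = 1 + [G : G_H]·[K : ℚ_p]` (local class field theory,
`freeProlRank_map_aug_of_rank` + `thm26_ii_delta_gal_holds`).
[cite: MochizukiAbsTopI2012, Thm 2.6 (v) proof p.24] -/
theorem MLFBase.exists_openSubgroup_inputs_of_isAlmostPro (B : E.MLFBase) (H : Subgroup E.arith)
    (hH : IsOpen (H : Set E.arith)) {S : Set ℕ} (hΔ : E.GeomTFG) (hΔS : IsAlmostPro E.geom S) :
    ∃ a : H →ₜ* (H.map E.aug.toMonoidHom), Function.Surjective a ∧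
      (∀ M : Subgroup (H.map E.aug.toMonoidHom), M.Normal →
        IsClosed (M : Set (H.map E.aug.toMonoidHom)) → IsTopologicallyFinitelyGenerated M →
        IsAlmostProOmissive M → M = ⊥) ∧
      IsTopologicallyFinitelyGenerated a.toMonoidHom.ker ∧ IsAlmostPro a.toMonoidHom.ker S ∧
      (∀ (l : ℕ) [Fact l.Prime], l ≠ B.p → freeProlRank (H.map E.aug.toMonoidHom) l = 1) ∧
      @freeProlRank (H.map E.aug.toMonoidHom) _ _ B.p B.instPrime =
        ((1 + (H.map E.aug.toMonoidHom).index * Module.finrank ℚ_[B.p] B.K : ℕ) : ℕ∞) := by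
  letI := B.instPrime; letI := B.instField; letI := B.instAlgebra; letI := B.instFinite
  have hHc : IsClosed (H : Set E.arith) := H.isClosed_of_isOpen hH
  haveI : CompactSpace H := isCompact_iff_compactSpace.mp hHc.isCompact
  haveI : CompactSpace E.geom := isCompact_iff_compactSpace.mp E.isClosed_geom.isCompact
  set GH : Subgroup E.gal := H.map E.aug.toMonoidHom with hGHdef
  haveI : Finite (E.arith ⧸ H) := Subgroup.quotient_finite_of_isOpen H hH
  haveI : H.FiniteIndex := Subgroup.finiteIndex_of_finite_quotient
  haveI : GH.FiniteIndex :=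
    ⟨fun h0 => Subgroup.FiniteIndex.index_ne_zero (H := H)
      (Nat.eq_zero_of_zero_dvd (h0 ▸ Subgroup.index_map_dvd H E.aug_surjective))⟩
  have hGHc : IsClosed (GH : Set E.gal) := by
    rw [hGHdef, Subgroup.coe_map]
    exact (hHc.isCompact.image (map_continuous E.aug)).isClosed
  have hGHo : IsOpen (GH : Set E.gal) := GH.isOpen_of_isClosed_of_finiteIndex hGHc
  let a : H →ₜ* GH :=
    ⟨E.aug.toMonoidHom.subgroupMap H,
      Continuous.subtype_mk ((map_continuous E.aug).comp continuous_subtype_val) _⟩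
  have ha : Function.Surjective a := E.aug.toMonoidHom.subgroupMap_surjective H
  have hmem : ∀ y : H, y ∈ a.toMonoidHom.ker ↔ (y : E.arith) ∈ E.geom := by
    intro y
    rw [MonoidHom.mem_ker, mem_geom, Subtype.ext_iff]
    rfl
  let e : ↥(E.geom ⊓ H) ≃ₜ* ↥(a.toMonoidHom.ker) :=
    { toFun := fun x => ⟨⟨x.1, x.2.2⟩, (hmem _).2 x.2.1⟩
      invFun := fun y => ⟨y.1.1, ⟨(hmem _).1 y.2, y.1.2⟩⟩
      left_inv := fun _ => rfl
      right_inv := fun _ => rfl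
      map_mul' := fun _ _ => rfl
      continuous_toFun :=
        Continuous.subtype_mk (Continuous.subtype_mk continuous_subtype_val _) _
      continuous_invFun :=
        Continuous.subtype_mk (continuous_subtype_val.comp continuous_subtype_val) _ }
  let V : Subgroup E.geom := (E.geom ⊓ H).subgroupOf E.geom
  have hVo : IsOpen (V : Set E.geom) := by
    have hV : (V : Set E.geom) = Subtype.val ⁻¹' (H : Set E.arith) := by
      ext x
      simp only [V, SetLike.mem_coe, Subgroup.mem_subgroupOf, Subgroup.mem_inf, Set.mem_preimage]
      exact ⟨fun h => h.2, fun h => ⟨x.2, h⟩⟩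
    rw [hV]
    exact hH.preimage continuous_subtype_val
  let e₀ : V ≃* ↥(E.geom ⊓ H) := Subgroup.subgroupOfEquivOfLe inf_le_left
  let e' : V ≃ₜ* ↥(E.geom ⊓ H) :=
    { e₀ with
      continuous_toFun := by
        refine Continuous.subtype_mk ?_ _
        exact continuous_subtype_val.comp continuous_subtype_val
      continuous_invFun := by
        refine Continuous.subtype_mk (Continuous.subtype_mk continuous_subtype_val _) _ }
  have hΔHfg : IsTopologicallyFinitelyGenerated (a.toMonoidHom.ker) :=
    ((hΔ.subgroup_isOpen V hVo).of_continuousMulEquiv e').of_continuousMulEquiv e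
  have hΔHS : IsAlmostPro (a.toMonoidHom.ker) S :=
    (E.isAlmostPro_geom_inf_of_isOpen hΔS H hH).of_continuousMulEquiv e
  obtain ⟨hl1, hp1⟩ := freeProlRank_map_aug_of_rank thm26_ii_delta_gal_holds E B H hH
  refine ⟨a, ha, fun M hn hc hfg hapo =>
    MLFBase.eq_bot_of_isAlmostProOmissive_of_isOpen B GH hGHo M hn hc hfg hapo, hΔHfg, hΔHS, hl1, ?_⟩
  rw [hp1, Nat.add_comm]

/-- **[AbsTopI] Thm 2.6 (iii), first clause, for EVERY open subgroup `H ⊆ Π`, `Δ` ALMOST pro-`Σ`: `θ²(H) ⊆ Σ`** — from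
`deltaInv_two_eq_zero_of_isAlmostPro` (corestriction route) (`δ²_l(J) = 0` for every open `J ⊆ Π`,
`l ∉ Σ`), since an open `J′ ⊆ H` is an open subgroup of `Π` ("by applying the analogue of this
conclusion for an arbitrary open subgroup", p. 23).  Inputs: MLF base data, `Π` topologically
finitely generated (Thm 2.6 (ii) clause one), `Δ` pro-`Σ`. [cite: MochizukiAbsTopI2012, Thm 2.6 (iii) p.22] -/
theorem MLFBase.thetaSet_two_subset_of_isOpen_of_isAlmostPro (B : E.MLFBase) {S : Set ℕ}
    (htfg : IsTopologicallyFinitelyGenerated E.arith) (hΔS : IsAlmostPro E.geom S)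
    (H : Subgroup E.arith) (hH : IsOpen (H : Set E.arith)) :
    thetaSet H 2 ⊆ {l ∈ S | l.Prime} := by
  intro l hl
  obtain ⟨hlp, hle⟩ := hl
  refine ⟨?_, hlp⟩
  by_contra hlS
  haveI : Fact l.Prime := ⟨hlp⟩
  have h0 : epsilonInv H 2 l = 0 := by
    refine nonpos_iff_eq_zero.mp ?_
    unfold epsilonInv
    refine iSup₂_le fun J' hJ' => ?_
    have hJo : IsOpen ((J'.map H.subtype : Subgroup E.arith) : Set E.arith) := by
      have h1 : ((J'.map H.subtype : Subgroup E.arith) : Set E.arith) = Subtype.val '' (J' : Set H) := by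
        rw [Subgroup.coe_map]; rfl
      rw [h1]
      exact hH.isOpenMap_subtype_val _ hJ'
    have hmemH : ∀ y : (J'.map H.subtype : Subgroup E.arith), (y : E.arith) ∈ H := fun y => by
      obtain ⟨x, -, hxy⟩ := y.2
      rw [← hxy]
      exact x.2
    have hmemJ : ∀ y : (J'.map H.subtype : Subgroup E.arith), (⟨(y : E.arith), hmemH y⟩ : H) ∈ J' :=
      fun y => by
      obtain ⟨x, hx, hxy⟩ := y.2
      have hx' : (⟨(y : E.arith), hmemH y⟩ : H) = x := Subtype.ext hxy.symm
      rw [hx']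
      exact hx
    let e : J' ≃ₜ* (J'.map H.subtype : Subgroup E.arith) :=
      { toFun := fun x => ⟨(x : H), ⟨x, x.2, rfl⟩⟩
        invFun := fun y => ⟨⟨(y : E.arith), hmemH y⟩, hmemJ y⟩
        left_inv := fun _ => rfl
        right_inv := fun _ => rfl
        map_mul' := fun _ _ => rfl
        continuous_toFun := (continuous_subtype_val.comp continuous_subtype_val).subtype_mk _
        continuous_invFun := (continuous_subtype_val.subtype_mk _).subtype_mk _ }
    rw [deltaInv_eq_of_continuousMulEquiv e 2 l, E.deltaInv_two_eq_zero_of_isAlmostPro B htfg hΔS hlS hJo]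
  have h1 : ((3 - 2 : ℕ) : ℕ∞) ≤ 0 := h0 ▸ hle
  norm_num at h1

/-- **[AbsTopI] Thm 2.6 (v), general form, with (iii) clause one DISCHARGED, `Δ` ALMOST pro-`Σ`** (twin of `MLFBase.thm26vFull_of_isProSet_of_tfg`) — for every extension
with MLF base data `G ≅ G_K` and construction-data prime set `Σ ⊆ Primes`, GIVEN: `Δ` topologically
finitely generated (Prop 2.2, `E.GeomTFG`), `Π` topologically finitely generated (Thm 2.6 (ii) clause
one; `MLFBase.isTopologicallyFinitelyGenerated_arith_of_localEPC` from Prop 2.2 + Tate's local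
Euler–Poincaré characteristic), `Δ` pro-`Σ`, and — ONLY in case every prime lies in `Σ` — the rank
identity of (ii) for every open `Π′` ("`δ¹_l(Π′) = δ¹_l(G′) + m`") and the second clause of (iii) for
every open `H` ("`|θ¹(H)| ≥ 2 ⇒ θ²(H) = Primes`").  Then `E.Thm26vFull B`.
[cite: MochizukiAbsTopI2012, Thm 2.6 (v) p.22] -/
theorem MLFBase.thm26vFull_of_isAlmostPro_of_tfg (B : E.MLFBase) (S : Set ℕ) (hS : S ⊆ {q | q.Prime})
    (hΔ : E.GeomTFG) (htfg : IsTopologicallyFinitelyGenerated E.arith) (hΔS : IsAlmostPro E.geom S)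
    (hQ : (∀ q : ℕ, q.Prime → q ∈ S) → ∀ (P : Subgroup E.arith), IsOpen (P : Set E.arith) →
      ∃ m : ℕ, ∀ (l : ℕ) [Fact l.Prime],
        freeProlRank P l = freeProlRank (P.map E.aug.toMonoidHom) l + m)
    (hiii₂ : (∀ q : ℕ, q.Prime → q ∈ S) → ∀ (H : Subgroup E.arith), IsOpen (H : Set E.arith) →
      2 ≤ (thetaSet H 1).encard → thetaSet H 2 = {l | l.Prime}) :
    E.Thm26vFull B := by
  letI := B.instPrime; letI := B.instField; letI := B.instAlgebra; letI := B.instFinite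
  -- every open `H`
  have hζ : ∀ (H : Subgroup E.arith), IsOpen (H : Set E.arith) →
      zetaTildeInv H =
        (((H.map E.aug.toMonoidHom).index * Module.finrank ℚ_[B.p] B.K : ℕ) : ℕ∞) := by
    intro H hH
    haveI : CompactSpace H :=
      isCompact_iff_compactSpace.mp (H.isClosed_of_isOpen hH).isCompact
    obtain ⟨a, ha, hΓ, hfg, hpro, hl1, hp1⟩ := MLFBase.exists_openSubgroup_inputs_of_isAlmostPro B H hH hΔ hΔS
    exact zetaTildeInv_eq_of_inputs'_of_isAlmostPro a ha hΓ B.p _ hp1 hl1 hS hfg hpro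
      (MLFBase.thetaSet_two_subset_of_isOpen_of_isAlmostPro B htfg hΔS H hH)
      (fun hall => hQ hall H hH) (fun hall => hiii₂ hall H hH)
  -- `Π` itself, transporting along `⊤ ≅ Π`
  have htop : IsOpen ((⊤ : Subgroup E.arith) : Set E.arith) := by
    rw [Subgroup.coe_top]; exact isOpen_univ
  obtain ⟨e⟩ := nonempty_continuousMulEquiv_of_eq_top (⊤ : Subgroup E.arith) rfl
  obtain ⟨e'⟩ := nonempty_continuousMulEquiv_of_eq_top
    ((⊤ : Subgroup E.arith).map E.aug.toMonoidHom) (Subgroup.map_top_of_surjective _ E.aug_surjective)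
  have hR := thm26_ii_delta_gal_holds B.p B.K
  have hl1 : ∀ (l : ℕ) [Fact l.Prime], l ≠ B.p → freeProlRank E.gal l = 1 := by
    intro l _ hl
    rw [freeProlRank_eq_of_continuousMulEquiv B.galIso l]
    exact hR.1 l hl
  have hp1 : @freeProlRank E.gal _ _ B.p B.instPrime =
      ((1 + Module.finrank ℚ_[B.p] B.K : ℕ) : ℕ∞) := by
    rw [freeProlRank_eq_of_continuousMulEquiv B.galIso B.p, hR.2, Nat.add_comm]
  have hiii₁top : thetaSet E.arith 2 ⊆ {l ∈ S | l.Prime} := by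
    rw [← thetaSet_eq_of_continuousMulEquiv e 2]
    exact MLFBase.thetaSet_two_subset_of_isOpen_of_isAlmostPro B htfg hΔS ⊤ htop
  have hζtop : zetaTildeInv E.arith = (Module.finrank ℚ_[B.p] B.K : ℕ) := by
    refine zetaTildeInv_eq_of_inputs'_of_isAlmostPro E.aug E.aug_surjective
      (fun M hn hc hfg hapo => MLFBase.eq_bot_of_isAlmostProOmissive B M hn hc hfg hapo)
      B.p (Module.finrank ℚ_[B.p] B.K) hp1 hl1 hS hΔ hΔS hiii₁top (fun hall => ?_) (fun hall h2 => ?_)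
    · obtain ⟨m, hm⟩ := hQ hall ⊤ htop
      refine ⟨m, fun l _ => ?_⟩
      rw [← freeProlRank_eq_of_continuousMulEquiv e l, hm l, freeProlRank_eq_of_continuousMulEquiv e' l]
    · rw [← thetaSet_eq_of_continuousMulEquiv e 2, ← thetaSet_eq_of_continuousMulEquiv e 1] at *
      exact hiii₂ hall ⊤ htop h2
  exact MLFBase.thm26vFull_of_zetaTildeInv_eq B hζ hζtop

/-- **[AbsTopI] Thm 2.6 (v), GENERAL form, in the regime `Σ ≠ Primes` — kernel-checked from the HONEST
construction data alone (`Δ` ALMOST pro-`Σ`, Def 2.1 (i)).**  For every extension `1 → Δ → Π → G → 1` with MLF base data `G ≅ G_K`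
whose `Δ` is topologically finitely generated ([AbsTopI] Prop 2.2) and pro-`Σ` for a set of primes
`Σ` MISSING at least one prime, and whose `Π` is topologically finitely generated (Thm 2.6 (ii)
clause one): `ζ̃(Π) := ζ(Π/Θ) = [k : ℚ_p]` and `Δ = ⋂ {H open | ζ̃(H)/ζ̃(Π) = [Π : H]}` — the typed
`E.Thm26vFull B`.  This is exactly the regime in which `Θ ≠ {1}` (here `Θ_H = Δ ∩ H` for every open
`H`, by (iv) and (iii) clause one); no rank identity and no H²-injection input is needed (print
p. 24 l. 14–16: "If `Σ ≠ Primes`, then it follows from the definition of `Θ`, together with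
assertion (iv), that `Θ = Δ`, hence that `ζ(Π/Θ) = ζ(G) = [k : ℚ_p]`").
[cite: MochizukiAbsTopI2012, Thm 2.6 (v) p.22] -/
theorem MLFBase.thm26vFull_of_exists_prime_not_mem_of_isAlmostPro (B : E.MLFBase) {S : Set ℕ}
    (hS : S ⊆ {q | q.Prime}) (hq : ∃ q : ℕ, q.Prime ∧ q ∉ S) (hΔ : E.GeomTFG)
    (htfg : IsTopologicallyFinitelyGenerated E.arith) (hΔS : IsAlmostPro E.geom S) :
    E.Thm26vFull B := by
  obtain ⟨q, hq, hqS⟩ := hq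
  exact MLFBase.thm26vFull_of_isAlmostPro_of_tfg B S hS hΔ htfg hΔS
    (fun hall => absurd (hall q hq) hqS) (fun hall => absurd (hall q hq) hqS)

end FundamentalExtension

end Literature.AnabelianGeometry.AbsoluteAnabelian

end
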